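import Mathlib
import Summits.Ventures.DiscreteObjects.Mahler.TraceDiscRoot
import Summits.Ventures.DiscreteObjects.Mahler.TraceNu3Certificate
import Summits.Ventures.DiscreteObjects.Mahler.UnimodularRootReciprocal

/-!
# Trace certificates with two complex-conjugate pairs of trace roots (venture `DiscreteObjects`, target L)

Cell `pub-namedobj`, seat `pub-namedobj-mahler` (gen 11). Framing: lottery ticket; floor = certified
bounds/negative ranges.

When the trace polynomial `Q` (degree `d`) of a reciprocal `P = traceLift Q` has `d - 4` real roots and TWO
complex-conjugate pairs `y₁, ȳ₁, y₂, ȳ₂` (`ν = 4`), the quadratic-cofactor trick of `TraceNu2Structure` no longer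
separates the pairs.  Instead each pair is located by a DISC CERTIFICATE (`exists_root_near`, file `TraceDiscRoot`:
simplified Newton map + Banach fixed point, from rational data), and

  `M(traceLift Q) = ∏_{t real} M(x² - tx + 1) · M(x² - y₁x + 1)² · M(x² - y₂x + 1)²`,
  `M(x² - yx + 1) = r`, `r + r⁻¹ = (|y - 2| + |y + 2|)/2` (`mahlerMeasure_quad_complex`).

* `mahlerMeasure_quad_conj` — `M(x² - ȳx + 1) = M(x² - yx + 1)`;
* `traceRealComplex_structure` — the product formula for `T` distinct real roots and `Y` distinct roots in the
  upper half plane with `|T| + 2|Y| = d`;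
* `quad_measure_bounds_of_near` — `‖y - c‖ ≤ ρ` and rational bounds on `|c ∓ 2|` bracket `M(x² - yx + 1)`;
* `twoPairs_certificate` — the kernel certificate from rational data for `d - 4` inner real brackets and two discs
  (census core `c16_14`; MRW08 Table 1 rows `D = 32, 42, 44, 48, 52`);
* `twoPairs_outer_certificate` — the same with one more real trace root outside `[-2, 2]` (`ν = 5`: MRW `D = 54`).
-/

namespace Summit.Ventures.DiscreteObjects.Mahler

open Polynomial

/-- `M(x² - ȳx + 1) = M(x² - yx + 1)`. -/
theorem mahlerMeasure_quad_conj (y : ℂ) :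
    (X ^ 2 - C (starRingEnd ℂ y) * X + 1 : ℂ[X]).mahlerMeasure = (X ^ 2 - C y * X + 1 : ℂ[X]).mahlerMeasure := by
  obtain ⟨r, hr1, hry, hrA⟩ := mahlerMeasure_quad_complex y
  obtain ⟨r', hr1', hry', hrA'⟩ := mahlerMeasure_quad_complex (starRingEnd ℂ y)
  have hAA : ‖starRingEnd ℂ y - 2‖ + ‖starRingEnd ℂ y + 2‖ = ‖y - 2‖ + ‖y + 2‖ := by
    have e1 : starRingEnd ℂ y - 2 = starRingEnd ℂ (y - 2) := by rw [map_sub, map_ofNat]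
    have e2 : starRingEnd ℂ y + 2 = starRingEnd ℂ (y + 2) := by rw [map_add, map_ofNat]
    rw [e1, e2, Complex.norm_conj, Complex.norm_conj]
  rw [hry, hry']
  rw [hAA, ← hrA] at hrA'
  rcases lt_trichotomy r' r with h | h | h
  · exact absurd hrA' (ne_of_lt (add_inv_lt_add_inv hr1' h))
  · exact h
  · exact absurd hrA'.symm (ne_of_lt (add_inv_lt_add_inv hr1 h))

/-- **Product formula with real roots and upper-half-plane roots.**  `Q ∈ ℤ[X]` monic of degree `d`, `T` distinct
real roots, `Y` distinct roots with positive imaginary part, `|T| + 2|Y| = d`: then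
`M(traceLift Q) = ∏_{t∈T} M(x² - tx + 1) · ∏_{y∈Y} M(x² - yx + 1)²`. -/
theorem traceRealComplex_structure {Q : ℤ[X]} (hQ : Q.Monic) (T : Multiset ℝ) (hT : T.Nodup)
    (hroot : ∀ t ∈ T, aeval t Q = 0) (Y : Multiset ℂ) (hY : Y.Nodup) (hYroot : ∀ y ∈ Y, aeval y Q = 0)
    (hYim : ∀ y ∈ Y, 0 < y.im) (hcard : Multiset.card T + 2 * Multiset.card Y = Q.natDegree) :
    intMahlerMeasure (traceLift Q) =
      (T.map fun t => if |t| ≤ 2 then (1 : ℝ) else (|t| + Real.sqrt (t ^ 2 - 4)) / 2).prod *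
        (Y.map fun y => (X ^ 2 - C y * X + 1 : ℂ[X]).mahlerMeasure ^ 2).prod := by
  classical
  have hinj := (Int.castRingHom ℂ).injective_int
  set Qc : ℂ[X] := Q.map (Int.castRingHom ℂ) with hQc
  have hQc0 : Qc ≠ 0 := (Polynomial.map_ne_zero_iff hinj).mpr hQ.ne_zero
  have hmemQc : ∀ z : ℂ, aeval z Q = 0 → z ∈ Qc.roots := fun z hz => by
    rw [mem_roots hQc0, IsRoot.def, hQc, ← algebraMap_int_eq, eval_map_algebraMap]; exact hz
  set T' : Multiset ℂ := T.map (fun t : ℝ => (t : ℂ)) with hT'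
  set Yc : Multiset ℂ := Y.map (starRingEnd ℂ) with hYc
  set S : Multiset ℂ := T' + (Y + Yc) with hS
  have hT'n : T'.Nodup := hT.map Complex.ofReal_injective
  have hYcn : Yc.Nodup := hY.map (starRingEnd ℂ).injective
  have hT'im : ∀ z ∈ T', z.im = 0 := by
    intro z hz; obtain ⟨t, -, rfl⟩ := Multiset.mem_map.mp hz; simp
  have hYcim : ∀ z ∈ Yc, z.im < 0 := by
    intro z hz; obtain ⟨y, hy, rfl⟩ := Multiset.mem_map.mp hz; rw [Complex.conj_im]; linarith [hYim y hy]
  have hSn : S.Nodup := by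
    rw [hS, Multiset.nodup_add]
    refine ⟨hT'n, ?_, ?_⟩
    · rw [Multiset.nodup_add]
      refine ⟨hY, hYcn, Multiset.disjoint_left.mpr ?_⟩
      intro z hz hz'
      have := hYim z hz; have := hYcim z hz'; linarith
    · refine Multiset.disjoint_left.mpr ?_
      intro z hz hz'
      have h0 := hT'im z hz
      rcases Multiset.mem_add.mp hz' with h | h
      · have := hYim z h; linarith
      · have := hYcim z h; linarith
  have hSroots : ∀ z ∈ S, aeval z Q = 0 := by
    intro z hz
    rcases Multiset.mem_add.mp hz with h | h
    · obtain ⟨t, ht, rfl⟩ := Multiset.mem_map.mp h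
      rw [show ((t : ℝ) : ℂ) = algebraMap ℝ ℂ t from rfl, aeval_algebraMap_apply, hroot t ht, map_zero]
    · rcases Multiset.mem_add.mp h with h | h
      · exact hYroot z h
      · obtain ⟨y, hy, rfl⟩ := Multiset.mem_map.mp h
        exact aeval_conj_eq_zero (hYroot y hy)
  have hSle : S ≤ Qc.roots := by
    rw [Multiset.le_iff_subset hSn]
    intro z hz; exact hmemQc z (hSroots z hz)
  have hScard : Multiset.card S = Q.natDegree := by
    rw [hS, Multiset.card_add, Multiset.card_add, hT', hYc, Multiset.card_map, Multiset.card_map, ← hcard]; ring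
  have hRoots : Qc.roots = S := by
    symm; apply Multiset.eq_of_le_of_card_le hSle
    rw [hScard, ← natDegree_map_eq_of_injective hinj Q]
    exact card_roots' _
  rw [intMahlerMeasure_traceLift hQ, ← hQc, hRoots, hS, Multiset.map_add, Multiset.prod_add, Multiset.map_add,
    Multiset.prod_add, hT', hYc, Multiset.map_map, Multiset.map_map]
  have h1 : (T.map ((fun u : ℂ => (X ^ 2 - C u * X + 1 : ℂ[X]).mahlerMeasure) ∘ fun t : ℝ => (t : ℂ))) =
      T.map fun t => if |t| ≤ 2 then (1 : ℝ) else (|t| + Real.sqrt (t ^ 2 - 4)) / 2 :=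
    Multiset.map_congr rfl fun t _ => mahlerMeasure_quad_real t
  have h2 : (Y.map ((fun u : ℂ => (X ^ 2 - C u * X + 1 : ℂ[X]).mahlerMeasure) ∘ (starRingEnd ℂ))) =
      Y.map fun u : ℂ => (X ^ 2 - C u * X + 1 : ℂ[X]).mahlerMeasure :=
    Multiset.map_congr rfl fun y _ => mahlerMeasure_quad_conj y
  rw [h1, h2, ← Multiset.prod_map_mul]
  congr 1
  exact congrArg _ (Multiset.map_congr rfl fun y _ => by ring)

/-- **Bracket for one complex trace root near a Gaussian rational.**  If `‖y - (u + vi)‖ ≤ ρ` and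
`g₋² ≤ (u - 2)² + v² ≤ G₋²`, `g₊² ≤ (u + 2)² + v² ≤ G₊²` (`G₋, G₊ ≥ 0`), then `M(x² - yx + 1) = r` with `1 ≤ r` and
`(g₋ + g₊)/2 - ρ ≤ r + r⁻¹ ≤ (G₋ + G₊)/2 + ρ`. -/
theorem quad_measure_bounds_of_near {y : ℂ} {u v ρ gm gp Gm Gp : ℝ} (hy : ‖y - ⟨u, v⟩‖ ≤ ρ)
    (hgm : gm ^ 2 ≤ (u - 2) ^ 2 + v ^ 2) (hGm : (u - 2) ^ 2 + v ^ 2 ≤ Gm ^ 2) (hGm0 : 0 ≤ Gm)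
    (hgp : gp ^ 2 ≤ (u + 2) ^ 2 + v ^ 2) (hGp : (u + 2) ^ 2 + v ^ 2 ≤ Gp ^ 2) (hGp0 : 0 ≤ Gp) :
    ∃ r : ℝ, 1 ≤ r ∧ (X ^ 2 - C y * X + 1 : ℂ[X]).mahlerMeasure = r ∧
      (gm + gp) / 2 - ρ ≤ r + r⁻¹ ∧ r + r⁻¹ ≤ (Gm + Gp) / 2 + ρ := by
  obtain ⟨r, hr1, hry, hrA⟩ := mahlerMeasure_quad_complex y
  set c : ℂ := ⟨u, v⟩ with hc
  have hcm : ‖c - 2‖ ^ 2 = (u - 2) ^ 2 + v ^ 2 := by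
    rw [Complex.sq_norm, Complex.normSq_apply, hc]; simp; ring
  have hcp : ‖c + 2‖ ^ 2 = (u + 2) ^ 2 + v ^ 2 := by
    rw [Complex.sq_norm, Complex.normSq_apply, hc]; simp; ring
  have h1 : gm ≤ ‖c - 2‖ := (abs_le_of_sq_le_sq' (by rw [hcm]; exact hgm) (norm_nonneg _)).2
  have h2 : ‖c - 2‖ ≤ Gm := le_of_pow_le_pow_left₀ two_ne_zero hGm0 (by rw [hcm]; exact hGm)
  have h3 : gp ≤ ‖c + 2‖ := (abs_le_of_sq_le_sq' (by rw [hcp]; exact hgp) (norm_nonneg _)).2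
  have h4 : ‖c + 2‖ ≤ Gp := le_of_pow_le_pow_left₀ two_ne_zero hGp0 (by rw [hcp]; exact hGp)
  have e1 : y - 2 = (y - c) + (c - 2) := by ring
  have e2 : y + 2 = (y - c) + (c + 2) := by ring
  have h5 : ‖y - 2‖ ≤ ρ + ‖c - 2‖ := by rw [e1]; exact (norm_add_le _ _).trans (by linarith)
  have h6 : ‖y + 2‖ ≤ ρ + ‖c + 2‖ := by rw [e2]; exact (norm_add_le _ _).trans (by linarith)
  have h7 : ‖c - 2‖ - ρ ≤ ‖y - 2‖ := by
    have := abs_norm_sub_norm_le (y - 2) (c - 2)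
    rw [show (y - 2) - (c - 2) = y - c by ring] at this
    have := (abs_le.mp this).1
    linarith
  have h8 : ‖c + 2‖ - ρ ≤ ‖y + 2‖ := by
    have := abs_norm_sub_norm_le (y + 2) (c + 2)
    rw [show (y + 2) - (c + 2) = y - c by ring] at this
    have := (abs_le.mp this).1
    linarith
  refine ⟨r, hr1, hry, ?_, ?_⟩
  · rw [hrA]; linarith
  · rw [hrA]; linarith

/-- **Two-pair certificate from rational data** (`ν = 4`: all real trace roots inside `(-2, 2)`).  `Q ∈ ℤ[X]` monic
of degree `d`; `I` = `d - 4` disjoint inner sign-change brackets; two roots `y₁, y₂` near Gaussian rationals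
`u_j + v_j i` within `ρ_j` (from `exists_root_near`), with `ρ_j < v_j` and the discs separated; rational square-root
brackets `g, G` for `|c_j ∓ 2|` and `r`-brackets via `r + r⁻¹`; conclusion `lo < M(traceLift Q) < hi` for
`lo ≤ r₁L²·r₂L²`, `r₁U²·r₂U² ≤ hi`. -/
theorem twoPairs_certificate {Q : ℤ[X]} (hQ : Q.Monic) (I : List (ℝ × ℝ))
    (hlen : I.length + 4 = Q.natDegree)
    (hI : ∀ ab ∈ I, -2 < ab.1 ∧ ab.1 < ab.2 ∧ ab.2 < 2)
    (hsorted : I.Pairwise (fun ab cd => ab.2 ≤ cd.1))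
    (hsign : ∀ ab ∈ I, aeval ab.1 Q * aeval ab.2 Q < 0)
    {y₁ y₂ : ℂ} {u₁ v₁ ρ₁ u₂ v₂ ρ₂ : ℝ}
    (hy₁ : ‖y₁ - ⟨u₁, v₁⟩‖ ≤ ρ₁) (hy₁root : aeval y₁ Q = 0) (hv₁ : ρ₁ < v₁)
    (hy₂ : ‖y₂ - ⟨u₂, v₂⟩‖ ≤ ρ₂) (hy₂root : aeval y₂ Q = 0) (hv₂ : ρ₂ < v₂)
    (hsep : ρ₁ + ρ₂ < |u₁ - u₂|)
    {g₁m g₁p G₁m G₁p g₂m g₂p G₂m G₂p : ℝ}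
    (hg₁m : g₁m ^ 2 ≤ (u₁ - 2) ^ 2 + v₁ ^ 2) (hG₁m : (u₁ - 2) ^ 2 + v₁ ^ 2 ≤ G₁m ^ 2) (hG₁m0 : 0 ≤ G₁m)
    (hg₁p : g₁p ^ 2 ≤ (u₁ + 2) ^ 2 + v₁ ^ 2) (hG₁p : (u₁ + 2) ^ 2 + v₁ ^ 2 ≤ G₁p ^ 2) (hG₁p0 : 0 ≤ G₁p)
    (hg₂m : g₂m ^ 2 ≤ (u₂ - 2) ^ 2 + v₂ ^ 2) (hG₂m : (u₂ - 2) ^ 2 + v₂ ^ 2 ≤ G₂m ^ 2) (hG₂m0 : 0 ≤ G₂m)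
    (hg₂p : g₂p ^ 2 ≤ (u₂ + 2) ^ 2 + v₂ ^ 2) (hG₂p : (u₂ + 2) ^ 2 + v₂ ^ 2 ≤ G₂p ^ 2) (hG₂p0 : 0 ≤ G₂p)
    {r₁L r₁U r₂L r₂U lo hi : ℝ}
    (hr₁L : 1 ≤ r₁L) (hr₁L' : r₁L + r₁L⁻¹ < (g₁m + g₁p) / 2 - ρ₁) (hr₁U : 1 ≤ r₁U)
    (hr₁U' : (G₁m + G₁p) / 2 + ρ₁ < r₁U + r₁U⁻¹)
    (hr₂L : 1 ≤ r₂L) (hr₂L' : r₂L + r₂L⁻¹ < (g₂m + g₂p) / 2 - ρ₂) (hr₂U : 1 ≤ r₂U)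
    (hr₂U' : (G₂m + G₂p) / 2 + ρ₂ < r₂U + r₂U⁻¹)
    (hlo : lo ≤ r₁L ^ 2 * r₂L ^ 2) (hhi : r₁U ^ 2 * r₂U ^ 2 ≤ hi) :
    lo < intMahlerMeasure (traceLift Q) ∧ intMahlerMeasure (traceLift Q) < hi := by
  classical
  set g : ℝ → ℝ := fun y => aeval y Q with hgdef
  have hg : Continuous g := by
    rw [hgdef]; simp only [← eval_map_algebraMap]; exact Polynomial.continuous _
  obtain ⟨rs, hrslen, hrspw, hroots, -, -, -, -⟩ := exists_roots_in_intervals hg I hI hsorted hsign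
  have hrs2 : ∀ r ∈ rs, -2 < r ∧ r < 2 := by
    intro r hr
    obtain ⟨-, cd, hcd, h1, h2⟩ := hroots r hr
    obtain ⟨h3, -, h4⟩ := hI cd hcd
    exact ⟨by linarith, by linarith⟩
  set T : Multiset ℝ := (rs : Multiset ℝ) with hT
  have hTnodup : T.Nodup := Multiset.coe_nodup.mpr (hrspw.imp ne_of_lt)
  have hTroot : ∀ t ∈ T, aeval t Q = 0 := fun t ht => (hroots t (Multiset.mem_coe.mp ht)).1
  -- the two upper-half-plane roots
  have him : ∀ {y : ℂ} {u v ρ : ℝ}, ‖y - ⟨u, v⟩‖ ≤ ρ → ρ < v → 0 < y.im := by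
    intro y u v ρ hy hv
    have h := (Complex.abs_im_le_norm (y - ⟨u, v⟩)).trans hy
    rw [Complex.sub_im] at h
    have := (abs_le.mp h).1
    simp only at this
    linarith
  have hre : ∀ {y : ℂ} {u v ρ : ℝ}, ‖y - ⟨u, v⟩‖ ≤ ρ → |y.re - u| ≤ ρ := by
    intro y u v ρ hy
    have h := (Complex.abs_re_le_norm (y - ⟨u, v⟩)).trans hy
    rwa [Complex.sub_re] at h
  have hy₁im : 0 < y₁.im := him hy₁ hv₁
  have hy₂im : 0 < y₂.im := him hy₂ hv₂
  have hne : y₁ ≠ y₂ := by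
    intro h
    have h1 := hre hy₁; have h2 := hre hy₂
    rw [h] at h1
    have : |u₁ - u₂| ≤ ρ₁ + ρ₂ := by
      have := abs_sub_le u₁ y₂.re u₂
      rw [abs_sub_comm u₁ y₂.re] at this
      linarith
    linarith
  set Y : Multiset ℂ := {y₁, y₂} with hY
  have hYn : Y.Nodup := by rw [hY]; simp [hne]
  have hYroot : ∀ y ∈ Y, aeval y Q = 0 := by
    intro y hy; rw [hY, Multiset.insert_eq_cons, Multiset.mem_cons, Multiset.mem_singleton] at hy
    rcases hy with rfl | rfl; exacts [hy₁root, hy₂root]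
  have hYim : ∀ y ∈ Y, 0 < y.im := by
    intro y hy; rw [hY, Multiset.insert_eq_cons, Multiset.mem_cons, Multiset.mem_singleton] at hy
    rcases hy with rfl | rfl; exacts [hy₁im, hy₂im]
  have hcard : Multiset.card T + 2 * Multiset.card Y = Q.natDegree := by
    rw [hT, hY, Multiset.coe_card, hrslen, ← hlen]; simp
  have hM := traceRealComplex_structure hQ T hTnodup hTroot Y hYn hYroot hYim hcard
  have hprodT : (T.map fun t => if |t| ≤ 2 then (1 : ℝ) else (|t| + Real.sqrt (t ^ 2 - 4)) / 2).prod = 1 := by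
    have : (T.map fun t => if |t| ≤ 2 then (1 : ℝ) else (|t| + Real.sqrt (t ^ 2 - 4)) / 2) = T.map fun _ => (1 : ℝ) :=
      Multiset.map_congr rfl fun t ht => by
        rw [hT, Multiset.mem_coe] at ht
        rw [if_pos (abs_le.mpr ⟨(hrs2 t ht).1.le, (hrs2 t ht).2.le⟩)]
    rw [this, Multiset.map_const', Multiset.prod_replicate, one_pow]
  rw [hprodT, one_mul, hY, Multiset.insert_eq_cons, Multiset.map_cons, Multiset.prod_cons, Multiset.map_singleton,
    Multiset.prod_singleton] at hM
  obtain ⟨r₁, hr₁1, hr₁M, hr₁lo, hr₁hi⟩ := quad_measure_bounds_of_near hy₁ hg₁m hG₁m hG₁m0 hg₁p hG₁p hG₁p0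
  obtain ⟨r₂, hr₂1, hr₂M, hr₂lo, hr₂hi⟩ := quad_measure_bounds_of_near hy₂ hg₂m hG₂m hG₂m0 hg₂p hG₂p hG₂p0
  rw [hr₁M, hr₂M] at hM
  have h1 : r₁L < r₁ := lt_of_add_inv_lt_add_inv hr₁1 (by linarith) (by linarith)
  have h2 : r₁ < r₁U := lt_of_add_inv_lt_add_inv hr₁U (by linarith) (by linarith)
  have h3 : r₂L < r₂ := lt_of_add_inv_lt_add_inv hr₂1 (by linarith) (by linarith)
  have h4 : r₂ < r₂U := lt_of_add_inv_lt_add_inv hr₂U (by linarith) (by linarith)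
  have hr₁L0 : 0 ≤ r₁L := zero_le_one.trans hr₁L
  have hr₂L0 : 0 ≤ r₂L := zero_le_one.trans hr₂L
  rw [hM]
  constructor
  · calc lo ≤ r₁L ^ 2 * r₂L ^ 2 := hlo
      _ < r₁ ^ 2 * r₂ ^ 2 := by
          apply mul_lt_mul'' (pow_lt_pow_left₀ h1 hr₁L0 two_ne_zero) (pow_lt_pow_left₀ h3 hr₂L0 two_ne_zero)
            (pow_nonneg hr₁L0 2) (pow_nonneg hr₂L0 2)
  · calc r₁ ^ 2 * r₂ ^ 2 < r₁U ^ 2 * r₂U ^ 2 := by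
          apply mul_lt_mul'' (pow_lt_pow_left₀ h2 (by linarith) two_ne_zero) (pow_lt_pow_left₀ h4 (by linarith) two_ne_zero)
            (pow_nonneg (by linarith) 2) (pow_nonneg (by linarith) 2)
      _ ≤ hi := hhi


/-- **Two pairs and one outer real trace root** (`ν = 5`; MRW08 Table 1, `D = 54`): as `twoPairs_certificate`, with
one more sign-change bracket `(a₀, b₀)` outside `[-2, 2]` carrying rational bounds `m₀ ≤ |t| ≤ M₀` and an
`x`-bracket `xL + xL⁻¹ < m₀`, `M₀ < xU + xU⁻¹`; conclusion `lo < M(traceLift Q) < hi` for `lo ≤ xL·r₁L²·r₂L²`,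
`xU·r₁U²·r₂U² ≤ hi`. -/
theorem twoPairs_outer_certificate {Q : ℤ[X]} (hQ : Q.Monic) (I : List (ℝ × ℝ))
    (hlen : I.length + 5 = Q.natDegree)
    (hI : ∀ ab ∈ I, -2 < ab.1 ∧ ab.1 < ab.2 ∧ ab.2 < 2)
    (hsorted : I.Pairwise (fun ab cd => ab.2 ≤ cd.1))
    (hsign : ∀ ab ∈ I, aeval ab.1 Q * aeval ab.2 Q < 0)
    {a₀ b₀ : ℝ} (hab₀ : a₀ < b₀) (hout : b₀ < -2 ∨ 2 < a₀) (hsign₀ : aeval a₀ Q * aeval b₀ Q < 0)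
    {m₀ M₀ : ℝ} (hm₀ : 2 < m₀) (houter : ∀ t : ℝ, a₀ < t → t < b₀ → m₀ ≤ |t| ∧ |t| ≤ M₀)
    {xL xU : ℝ} (hxL : 1 ≤ xL) (hxL' : xL + xL⁻¹ < m₀) (hxU : 1 ≤ xU) (hxU' : M₀ < xU + xU⁻¹)
    {y₁ y₂ : ℂ} {u₁ v₁ ρ₁ u₂ v₂ ρ₂ : ℝ}
    (hy₁ : ‖y₁ - ⟨u₁, v₁⟩‖ ≤ ρ₁) (hy₁root : aeval y₁ Q = 0) (hv₁ : ρ₁ < v₁)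
    (hy₂ : ‖y₂ - ⟨u₂, v₂⟩‖ ≤ ρ₂) (hy₂root : aeval y₂ Q = 0) (hv₂ : ρ₂ < v₂)
    (hsep : ρ₁ + ρ₂ < |u₁ - u₂|)
    {g₁m g₁p G₁m G₁p g₂m g₂p G₂m G₂p : ℝ}
    (hg₁m : g₁m ^ 2 ≤ (u₁ - 2) ^ 2 + v₁ ^ 2) (hG₁m : (u₁ - 2) ^ 2 + v₁ ^ 2 ≤ G₁m ^ 2) (hG₁m0 : 0 ≤ G₁m)
    (hg₁p : g₁p ^ 2 ≤ (u₁ + 2) ^ 2 + v₁ ^ 2) (hG₁p : (u₁ + 2) ^ 2 + v₁ ^ 2 ≤ G₁p ^ 2) (hG₁p0 : 0 ≤ G₁p)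
    (hg₂m : g₂m ^ 2 ≤ (u₂ - 2) ^ 2 + v₂ ^ 2) (hG₂m : (u₂ - 2) ^ 2 + v₂ ^ 2 ≤ G₂m ^ 2) (hG₂m0 : 0 ≤ G₂m)
    (hg₂p : g₂p ^ 2 ≤ (u₂ + 2) ^ 2 + v₂ ^ 2) (hG₂p : (u₂ + 2) ^ 2 + v₂ ^ 2 ≤ G₂p ^ 2) (hG₂p0 : 0 ≤ G₂p)
    {r₁L r₁U r₂L r₂U lo hi : ℝ}
    (hr₁L : 1 ≤ r₁L) (hr₁L' : r₁L + r₁L⁻¹ < (g₁m + g₁p) / 2 - ρ₁) (hr₁U : 1 ≤ r₁U)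
    (hr₁U' : (G₁m + G₁p) / 2 + ρ₁ < r₁U + r₁U⁻¹)
    (hr₂L : 1 ≤ r₂L) (hr₂L' : r₂L + r₂L⁻¹ < (g₂m + g₂p) / 2 - ρ₂) (hr₂U : 1 ≤ r₂U)
    (hr₂U' : (G₂m + G₂p) / 2 + ρ₂ < r₂U + r₂U⁻¹)
    (hlo : lo ≤ xL * (r₁L ^ 2 * r₂L ^ 2)) (hhi : xU * (r₁U ^ 2 * r₂U ^ 2) ≤ hi) :
    lo < intMahlerMeasure (traceLift Q) ∧ intMahlerMeasure (traceLift Q) < hi := by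
  classical
  set g : ℝ → ℝ := fun y => aeval y Q with hgdef
  have hg : Continuous g := by
    rw [hgdef]; simp only [← eval_map_algebraMap]; exact Polynomial.continuous _
  obtain ⟨rs, hrslen, hrspw, hroots, -, -, -, -⟩ := exists_roots_in_intervals hg I hI hsorted hsign
  have hrs2 : ∀ r ∈ rs, -2 < r ∧ r < 2 := by
    intro r hr
    obtain ⟨-, cd, hcd, h1, h2⟩ := hroots r hr
    obtain ⟨h3, -, h4⟩ := hI cd hcd
    exact ⟨by linarith, by linarith⟩
  -- the outer root
  obtain ⟨t₀, hat, htb, hgt⟩ := exists_root_of_mul_neg hg hab₀ hsign₀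
  obtain ⟨hm₀t, hM₀t⟩ := houter t₀ hat htb
  have ht₀abs : 2 < |t₀| := lt_of_lt_of_le hm₀ hm₀t
  have ht₀rs : t₀ ∉ rs := by
    intro h
    obtain ⟨h1, h2⟩ := hrs2 t₀ h
    rcases hout with h | h <;> linarith
  set T : Multiset ℝ := t₀ ::ₘ (rs : Multiset ℝ) with hT
  have hTnodup : T.Nodup := by
    rw [hT, Multiset.nodup_cons]
    exact ⟨by rwa [Multiset.mem_coe], Multiset.coe_nodup.mpr (hrspw.imp ne_of_lt)⟩
  have hTroot : ∀ t ∈ T, aeval t Q = 0 := by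
    intro t ht
    rw [hT, Multiset.mem_cons, Multiset.mem_coe] at ht
    rcases ht with rfl | ht
    · exact hgt
    · exact (hroots t ht).1
  -- the two upper-half-plane roots
  have him : ∀ {y : ℂ} {u v ρ : ℝ}, ‖y - ⟨u, v⟩‖ ≤ ρ → ρ < v → 0 < y.im := by
    intro y u v ρ hy hv
    have h := (Complex.abs_im_le_norm (y - ⟨u, v⟩)).trans hy
    rw [Complex.sub_im] at h
    have := (abs_le.mp h).1
    simp only at this
    linarith
  have hre : ∀ {y : ℂ} {u v ρ : ℝ}, ‖y - ⟨u, v⟩‖ ≤ ρ → |y.re - u| ≤ ρ := by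
    intro y u v ρ hy
    have h := (Complex.abs_re_le_norm (y - ⟨u, v⟩)).trans hy
    rwa [Complex.sub_re] at h
  have hy₁im : 0 < y₁.im := him hy₁ hv₁
  have hy₂im : 0 < y₂.im := him hy₂ hv₂
  have hne : y₁ ≠ y₂ := by
    intro h
    have h1 := hre hy₁; have h2 := hre hy₂
    rw [h] at h1
    have : |u₁ - u₂| ≤ ρ₁ + ρ₂ := by
      have := abs_sub_le u₁ y₂.re u₂
      rw [abs_sub_comm u₁ y₂.re] at this
      linarith
    linarith
  set Y : Multiset ℂ := {y₁, y₂} with hY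
  have hYn : Y.Nodup := by rw [hY]; simp [hne]
  have hYroot : ∀ y ∈ Y, aeval y Q = 0 := by
    intro y hy; rw [hY, Multiset.insert_eq_cons, Multiset.mem_cons, Multiset.mem_singleton] at hy
    rcases hy with rfl | rfl; exacts [hy₁root, hy₂root]
  have hYim : ∀ y ∈ Y, 0 < y.im := by
    intro y hy; rw [hY, Multiset.insert_eq_cons, Multiset.mem_cons, Multiset.mem_singleton] at hy
    rcases hy with rfl | rfl; exacts [hy₁im, hy₂im]
  have hcard : Multiset.card T + 2 * Multiset.card Y = Q.natDegree := by
    rw [hT, hY, Multiset.card_cons, Multiset.coe_card, hrslen, ← hlen]; simp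
  have hM := traceRealComplex_structure hQ T hTnodup hTroot Y hYn hYroot hYim hcard
  -- the product over `T` is `x₀`
  set x₀ : ℝ := (|t₀| + Real.sqrt (t₀ ^ 2 - 4)) / 2 with hx₀
  obtain ⟨hx₀1, hx₀A⟩ := quadRoot_add_inv ht₀abs
  have hprodT : (T.map fun t => if |t| ≤ 2 then (1 : ℝ) else (|t| + Real.sqrt (t ^ 2 - 4)) / 2).prod = x₀ := by
    rw [hT, Multiset.map_cons, Multiset.prod_cons, if_neg (not_le.mpr ht₀abs)]
    have : ((rs : Multiset ℝ).map fun t => if |t| ≤ 2 then (1 : ℝ) else (|t| + Real.sqrt (t ^ 2 - 4)) / 2) =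
        (rs : Multiset ℝ).map fun _ => (1 : ℝ) :=
      Multiset.map_congr rfl fun t ht => by
        rw [Multiset.mem_coe] at ht
        rw [if_pos (abs_le.mpr ⟨(hrs2 t ht).1.le, (hrs2 t ht).2.le⟩)]
    rw [this, Multiset.map_const', Multiset.prod_replicate, one_pow, mul_one]
  rw [hprodT, hY, Multiset.insert_eq_cons, Multiset.map_cons, Multiset.prod_cons, Multiset.map_singleton,
    Multiset.prod_singleton] at hM
  obtain ⟨r₁, hr₁1, hr₁M, hr₁lo, hr₁hi⟩ := quad_measure_bounds_of_near hy₁ hg₁m hG₁m hG₁m0 hg₁p hG₁p hG₁p0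
  obtain ⟨r₂, hr₂1, hr₂M, hr₂lo, hr₂hi⟩ := quad_measure_bounds_of_near hy₂ hg₂m hG₂m hG₂m0 hg₂p hG₂p hG₂p0
  rw [hr₁M, hr₂M] at hM
  have hxL'' : xL < x₀ := lt_of_add_inv_lt_add_inv hx₀1.le (by linarith) (by rw [hx₀A]; linarith)
  have hxU'' : x₀ < xU := lt_of_add_inv_lt_add_inv hxU (by linarith) (by rw [hx₀A]; linarith)
  have h1 : r₁L < r₁ := lt_of_add_inv_lt_add_inv hr₁1 (by linarith) (by linarith)
  have h2 : r₁ < r₁U := lt_of_add_inv_lt_add_inv hr₁U (by linarith) (by linarith)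
  have h3 : r₂L < r₂ := lt_of_add_inv_lt_add_inv hr₂1 (by linarith) (by linarith)
  have h4 : r₂ < r₂U := lt_of_add_inv_lt_add_inv hr₂U (by linarith) (by linarith)
  have hr₁L0 : 0 ≤ r₁L := zero_le_one.trans hr₁L
  have hr₂L0 : 0 ≤ r₂L := zero_le_one.trans hr₂L
  have hxL0 : 0 ≤ xL := zero_le_one.trans hxL
  have hx₀0 : 0 < x₀ := zero_lt_one.trans hx₀1
  have hsqL : r₁L ^ 2 * r₂L ^ 2 < r₁ ^ 2 * r₂ ^ 2 :=
    mul_lt_mul'' (pow_lt_pow_left₀ h1 hr₁L0 two_ne_zero) (pow_lt_pow_left₀ h3 hr₂L0 two_ne_zero)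
      (pow_nonneg hr₁L0 2) (pow_nonneg hr₂L0 2)
  have hsqU : r₁ ^ 2 * r₂ ^ 2 < r₁U ^ 2 * r₂U ^ 2 :=
    mul_lt_mul'' (pow_lt_pow_left₀ h2 (by linarith) two_ne_zero) (pow_lt_pow_left₀ h4 (by linarith) two_ne_zero)
      (pow_nonneg (by linarith) 2) (pow_nonneg (by linarith) 2)
  have hsq0 : 0 < r₁ ^ 2 * r₂ ^ 2 := by positivity
  rw [hM]
  constructor
  · calc lo ≤ xL * (r₁L ^ 2 * r₂L ^ 2) := hlo
      _ ≤ xL * (r₁ ^ 2 * r₂ ^ 2) := mul_le_mul_of_nonneg_left hsqL.le hxL0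
      _ < x₀ * (r₁ ^ 2 * r₂ ^ 2) := mul_lt_mul_of_pos_right hxL'' hsq0
  · calc x₀ * (r₁ ^ 2 * r₂ ^ 2) < xU * (r₁ ^ 2 * r₂ ^ 2) := mul_lt_mul_of_pos_right hxU'' hsq0
      _ ≤ xU * (r₁U ^ 2 * r₂U ^ 2) := mul_le_mul_of_nonneg_left hsqU.le (zero_le_one.trans hxU)
      _ ≤ hi := hhi

end Summit.Ventures.DiscreteObjects.Mahler
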